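import Summits.BirchSwinnertonDyer.BirchSwinnertonDyer.Theses.NormCapitulation

/-!
# Crux `PhantomCapitulation` (stmt-BirchSwinnertonDyer-17969) — birth skeleton `Lines/birth.lean`

Route `NormCapitulation` (route-BirchSwinnertonDyer-NormCapitulation), crux #3 (rank 3, the SURVIVAL
branch of the capitulation dichotomy): for `V/ℚ` globally minimal elliptic, `p ≥ 5` good ordinary with
`E[p]` irreducible, a Heegner field `K` (imaginary quadratic, `d_K < -4`, `(d_K, N·p) = 1`, every
`q ∣ N` split) and an anticyclotomic `ℤ_p`-extension `κ` of `K` with layers `K_n = κ.layer n`: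
every `p`-primary class `ξ ∈ Ш(E/K) = (V.baseChange K).sha` that is infinitely `p`-divisible in
`Ш(E/K)` restricts to `0` in `Ш(E/K_n)` for some `n` (`shaRestriction` along `K → K_n`). The crux is
FIXED (decl `Summit.BirchSwinnertonDyer.BirchSwinnertonDyer.Theses.NormCapitulation.PhantomCapitulation`);
this file registers one line for it and proves nothing beyond the composition.

## Line `birth` — tower annihilator + divisible hull (2 stubs + composition)

Mechanism (Greenberg LNM 1716 §§1, 4; Bertolini 1995; Matar arXiv:1709.06455): the divisible part
`D = div Ш(E/K)[p^∞]` maps Γ-equivariantly into `Ш(E/K_∞)[p^∞]^Γ = lim→ₙ Ш(E/K_n)[p^∞]`, whose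
kernel is EXACTLY the capitulation `⋃ₙ ker(Ш(E/K) → Ш(E/K_n))`. If the image of `Ш(E/K)[p^∞]`
upstairs has bounded exponent `p^B` (e.g. because `Ш(E/K_∞)[p^∞]^Γ` is finite: the anticyclotomic
`Ш` is `Λ`-cotorsion with `T ∤ char_Λ`, Bertolini 1995 §§5–6 in the `p ∤ [E(K):ℤy_K]` case), then
the image of `D` is divisible of bounded exponent, hence `0`, i.e. `D` capitulates. The line names
the two halves of this argument, both stated at FINITE layers over the tree's `sha` /
`shaRestriction` / `ZpExtension.layer` (no `K_∞`-object is needed):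

* `stub_towerAnnihilator` (OPEN — the Iwasawa-theoretic core, crux-sized): under the crux's
  hypotheses there is `B` such that EVERY `p`-primary `ξ ∈ Ш(E/K)` satisfies
  `p^B · res_{K_n/K}(ξ) = 0` for some layer `n` (depending on `ξ`) — "a uniform power of `p` kills
  every `p`-primary `Ш(E/K)`-class somewhere up the anticyclotomic tower"; equivalently the image
  of `Ш(E/K)[p^∞]` in `lim→ₙ Ш(E/K_n)` has bounded exponent. No divisibility hypothesis: this is
  the form in which finiteness of `Ш(E/K_∞)[p^∞]^Γ` (`T ∤ char_Λ Ш(E/K_∞)[p^∞]^∨` + control at the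
  trivial character) delivers it. Trivially true (with `n = 0`) whenever `Ш(E/K)[p^∞]` is finite;
  its content is the phantom regime `corank ≥ 1`, exactly as for the crux.
* `stub_divisibleHull` (PROVABLE NOW, pure algebra of cofinite-type `p`-groups, size M): for an
  elliptic curve over a number field, an infinitely `p`-divisible `p`-primary `ξ ∈ Ш` has, for
  every `m`, a `p^m`-th root `η` which is again `p`-primary and infinitely `p`-divisible (the
  infinitely divisible `p`-primary classes form a `p`-DIVISIBLE subgroup). Proof plan: `Ш[p]` is
  finite (`WeierstrassCurve.finite_sha_torsionBy_holds`, AEC X.4.2(b)); for `k = 0, 1, 2, …` pick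
  `y_k` with `p^(k+1) y_k = ξ` and put `z_k = p^k y_k`, so `p z_k = ξ`, `z_k ∈ p^k Ш`, `z_k`
  `p`-primary; the `z_k` lie in one coset of the finite `Ш[p]`, so (pigeonhole) one value `z` recurs
  for infinitely many `k`, whence `z ∈ ⋂_k p^k Ш`; induct on `m`.
* `PhantomCapitulation_of` — COMPOSITION (real proof, the crux BY NAME from the two stub
  signatures): given `ξ ∈ D`, take `B` from the annihilator, a `p^B`-th root `η ∈ D` of `ξ` from the
  hull, a layer `n` with `p^B · res_n η = 0`; then `res_n ξ = res_n (p^B η) = p^B res_n η = 0`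
  (`map_nsmul`). `PhantomCapitulation_skeleton` instantiates it with the stubs.

Honesty notes. (1) Modulo `stub_divisibleHull` (provable) and the structure theorem
`Ш(E/K)[p^∞] = D ⊕ (finite)` (finite `Ш[p]`), `stub_towerAnnihilator` is EQUIVALENT to the crux
(crux ⇒ annihilator: `p^B` = exponent of the finite complement kills it, `D` capitulates); it is the
load-bearing stub and carries the crux's open content in the form the Iwasawa mechanism outputs —
neither direction is a one-liner (BC3 probes below fail both for `→ crux` and `→ summit`). No cut of
this crux into two OPEN, strictly weaker pieces is known: every printed capitulation / non-survival
result for divisible `Ш` in a `ℤ_p`-tower (Bertolini 1995, Matar 2016/2021, Çiperiani–Wiles 2008 in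
ring class towers) proves finiteness of the relevant `Γ`-invariants wholesale. (2) Foreseen split of
`stub_towerAnnihilator` (NOT filed; needs the identification of `Ш(E/K_n)` = the tree's `sha` of the
base change to `κ.layer n` with Galois cohomology over the open subgroup `κ.layerSubgroup n ≤ Γ_K`,
i.e. `subgroupH1` / `selmerLayer` of `IwasawaSelmer.lean`): (a) `Λ`-COTORSION of the anticyclotomic
`Ш(E/K_∞)[p^∞]` with `T ∤ char` (open when `y_K` is torsion — the route's why-might-fail), (b) CONTROL
at the trivial character (Greenberg LNM 1716 Thm. 1.2-type, provable in kind: tree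
`IwasawaSelmerControl*`). (3) Disproof used: none relevant — no `Disproof.lean` exists for this crux
(`ledger crux ls stmt-BirchSwinnertonDyer-17969`: no workfiles, 2026-08-17); the summit's negatives
index (1 entry, LeadingTerm `TamePinch`: CM curves lack an admissible prime) concerns neither `Ш`
over `K` nor capitulation. (4) Prior art for this item: the route planner's birth evidence
`PhantomCapitulation_birth_tree.lean` (stubs `divisible_hull` + `divisible_lines_die`, 08:59Z) is not
readable from this hub (gate-side evidence store); this file is an independent re-typing whose open
stub is the divisibility-free annihilator rather than "divisible lines die".
-/

-- D-0017: single-problem summit, so `Summit.BirchSwinnertonDyer.BirchSwinnertonDyer.…` repeats a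
-- namespace BY DESIGN.
set_option linter.dupNamespace false

namespace Summit.BirchSwinnertonDyer.BirchSwinnertonDyer.Cruxes.PhantomCapitulation.Birth

open Literature

/-! ## §1 Stubs (registered; signatures inlined over tree declarations; the ONLY sorries of the file) -/

/-- **Stub `towerAnnihilator` (OPEN, load-bearing, crux-sized).** Under the crux's hypotheses, a
uniform power `p^B` kills every `p`-primary class of `Ш(E/K)` at some finite layer `K_n` of the
anticyclotomic tower (the layer depending on the class): the image of `Ш(E/K)[p^∞]` in
`lim→ₙ Ш(E/K_n) = Ш(E/K_∞)` has bounded exponent. Why plausibly true: with `n = 0` it holds as soon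
as `Ш(E/K)[p^∞]` is finite (conjecturally always; known for `r_an(E/K) = 1` with `p ∤ [E(K):ℤy_K]`,
Kolyvagin / Bertolini 1995, and then even `Ш(E/K_n)[p^∞] = 0` up the tower, Matar arXiv:1709.06455);
in general it follows from finiteness of `Ш(E/K_∞)[p^∞]^Γ`, i.e. `Λ`-cotorsion of the anticyclotomic
`Ш` with `T ∤ char_Λ` plus control at the trivial character (Greenberg LNM 1716 §§1, 4). Why it might
fail: a `Γ`-surviving phantom (`T ∣ char_Λ Ш(E/K_∞)[p^∞]^∨`) is excluded by nothing when `y_K` is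
torsion. Size: XL (open problem). Leans on (for the attack, not the statement): `IwasawaSelmer`
(`selmerInfty`, `SelmerDualData.charIdeal`), `IwasawaSelmerControl*`, `HeegnerModuleIndex`
(`Howard2004_thmB`), `AnticyclotomicCompactSelmer`. [cite: GreenbergLNM1716, §1 and §4]
[cite: Bertolini1995] [cite: arXiv:1709.06455] -/
theorem stub_towerAnnihilator : ∀ (V : WeierstrassCurve ℚ) [V.IsElliptic] [V.IsGloballyMinimal] (p : ℕ) [Fact p.Prime], 5 ≤ p → V.HasGoodReductionAtPrime p → ¬ (p : ℤ) ∣ V.frobeniusTrace p → V.HasIrreducibleModPGaloisRep p → ∀ (K : Type) [Field K] [NumberField K], (Module.finrank ℚ K = 2 ∧ NumberField.IsTotallyComplex K ∧ NumberField.discr K < -4 ∧ Int.gcd (NumberField.discr K) (V.conductorNorm ℤ * p) = 1 ∧ (∀ q : ℕ, q.Prime → q ∣ V.conductorNorm ℤ → ((Ideal.span {(q : ℤ)}).primesOver (NumberField.RingOfIntegers K)).ncard = 2)) → ∀ κ : Literature.NumberTheory.EllipticCurves.ZpExtension K p, κ.IsAnticyclotomic → ∃ B : ℕ, ∀ ξ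 : ↥(V.baseChange K).sha, (∃ k : ℕ, p ^ k • ξ = 0) → ∃ (n : ℕ) (_ : NumberField ↥(κ.layer n)), p ^ B • Literature.NumberTheory.EllipticCurves.shaRestriction (V.baseChange K) ↥(κ.layer n) ξ = 0 := by
  sorry

/-- **Stub `divisibleHull` (PROVABLE NOW, size M).** For an elliptic curve `W` over a number field
`K`, a prime `p` and `m : ℕ`: every infinitely `p`-divisible `p`-primary `ξ ∈ Ш(W)` has a `p^m`-th
root `η ∈ Ш(W)` that is again `p`-primary and infinitely `p`-divisible. Why true: `Ш(W)[p]` is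
finite (`WeierstrassCurve.finite_sha_torsionBy_holds`, Silverman AEC Thm. X.4.2(b)), and in an
abelian group with finite `p`-torsion the infinitely `p`-divisible `p`-primary elements form a
`p`-divisible subgroup (pigeonhole on the finite fibre `{z : p z = ξ}` — see the module docstring;
equivalently `A[p^∞] = (ℚ_p/ℤ_p)^r ⊕ finite`, Fuchs, *Infinite Abelian Groups* I, §25). Size: M.
[cite: SilvermanAEC2009, Thm. X.4.2(b)] [cite: GreenbergLNM1716, §1] -/
theorem stub_divisibleHull : ∀ (K : Type) [Field K] [NumberField K] (W : WeierstrassCurve K) [W.IsElliptic] (p : ℕ) [Fact p.Prime] (m : ℕ) (ξ : ↥W.sha), (∃ k : ℕ, p ^ k • ξ = 0) → (∀ k : ℕ, ∃ η : ↥W.sha, p ^ k • η = ξ) → ∃ η : ↥W.sha, p ^ m • η = ξ ∧ (∃ k : ℕ, p ^ k • η = 0) ∧ (∀ k : ℕ, ∃ θ : ↥W.sha, p ^ k • θ = η) := by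
  sorry

/-! ## §2 Composition: the crux from the two stub signatures (real proof, no `sorry`; hypotheses = verbatim the types of `stub_towerAnnihilator` / `stub_divisibleHull`) -/

/-- **Composition (line `birth`) — the skeleton theorem.** The crux `PhantomCapitulation`, BY NAME,
from the two stub SIGNATURES and nothing else: for `ξ ∈ D = div Ш(E/K)[p^∞]` take the uniform
exponent `B` of the annihilator, a `p^B`-th root `η ∈ D` of `ξ` (hull), and a layer `n` where
`p^B · res_n η = 0`; then `res_n ξ = res_n (p^B η) = p^B · res_n η = 0` since `shaRestriction` is a
homomorphism (`map_nsmul`). No `sorry` of its own (axioms of this declaration: `propext`,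
`Classical.choice`, `Quot.sound`). [cite: GreenbergLNM1716, §1 and §4] -/
theorem PhantomCapitulation_of :
    (∀ (V : WeierstrassCurve ℚ) [V.IsElliptic] [V.IsGloballyMinimal] (p : ℕ) [Fact p.Prime], 5 ≤ p → V.HasGoodReductionAtPrime p → ¬ (p : ℤ) ∣ V.frobeniusTrace p → V.HasIrreducibleModPGaloisRep p → ∀ (K : Type) [Field K] [NumberField K], (Module.finrank ℚ K = 2 ∧ NumberField.IsTotallyComplex K ∧ NumberField.discr K < -4 ∧ Int.gcd (NumberField.discr K) (V.conductorNorm ℤ * p) = 1 ∧ (∀ q : ℕ, q.Prime → q ∣ V.conductorNorm ℤ → ((Ideal.span {(q : ℤ)}).primesOver (NumberField.RingOfIntegers K)).ncard = 2)) → ∀ κ : Literature.NumberTheory.EllipticCurves.ZpExtension K p, κ.IsAnticyclotomic → ∃ B : ℕ, ∀ ξ : ↥(V.baseChange K).sha, (∃ k : ℕ, p ^ k • ξ = 0) → ∃ (n : ℕ) (_ : NumberField ↥(κ.layer n)), p ^ B • Literature.NumberTheory.EllipticCurves.shaRestriction (V.baseChange K) ↥(κ.layer n) ξ = 0) →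
    (∀ (K : Type) [Field K] [NumberField K] (W : WeierstrassCurve K) [W.IsElliptic] (p : ℕ) [Fact p.Prime] (m : ℕ) (ξ : ↥W.sha), (∃ k : ℕ, p ^ k • ξ = 0) → (∀ k : ℕ, ∃ η : ↥W.sha, p ^ k • η = ξ) → ∃ η : ↥W.sha, p ^ m • η = ξ ∧ (∃ k : ℕ, p ^ k • η = 0) ∧ (∀ k : ℕ, ∃ θ : ↥W.sha, p ^ k • θ = η)) →
      Summit.BirchSwinnertonDyer.BirchSwinnertonDyer.Theses.NormCapitulation.PhantomCapitulation := by
  intro hAnn hHull V _ _ p _ h5 hgood hord hirr K _ _ hK κ hκ ξ hξt hξd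
  -- the uniform exponent `p ^ B` killing every `p`-primary class somewhere up the tower
  obtain ⟨B, hB⟩ := hAnn V p h5 hgood hord hirr K hK κ hκ
  -- a `p ^ B`-th root `η` of `ξ` inside the divisible hull `D`
  obtain ⟨η, hη, hηt, -⟩ := hHull K (V.baseChange K) p B ξ hξt hξd
  -- `η` is `p`-primary, so `p ^ B • res_n η = 0` at some layer `n`
  obtain ⟨n, inst, hn⟩ := hB η hηt
  refine ⟨n, inst, ?_⟩
  rw [← hη, map_nsmul]
  exact hn

/-- **Registered target.** The crux decl itself, from the two stubs (closed = false exactly through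
`stub_towerAnnihilator` and `stub_divisibleHull`). -/
theorem PhantomCapitulation_skeleton :
    Summit.BirchSwinnertonDyer.BirchSwinnertonDyer.Theses.NormCapitulation.PhantomCapitulation :=
  PhantomCapitulation_of stub_towerAnnihilator stub_divisibleHull

end Summit.BirchSwinnertonDyer.BirchSwinnertonDyer.Cruxes.PhantomCapitulation.Birth
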